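import Mathlib.Data.Fintype.Basic
import Mathlib.Data.Finset.Card
import Mathlib.Data.Fintype.Card
import Mathlib.Tactic
import HarnessLib

/-!
# Corank functions on the subsets of `[n]` — the combinatorial half of `Prop9_1_ours_holds` (row 110 file c,
# `S01S09Interface.Prop9_1_ours`: [Hu25] Prop. 9.1 = Lafforgue's Proposition p.4, READ AT FIELD-VALUED POINTS over the
# OCCURRING strata). res-type-024 gen 11. Mathlib-only (no Hu import): lands independently of the S files.

For a `d`-plane `F ≤ K^n` the function `δ_F : I ↦ dim_K(F ∩ E_I)` has the three properties [Hu25] §9 prints (chunk p0072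
l.28–34: `δ ∅ = 0`, `δ [n] = d`, supermodularity) AND two it does not print (monotone, unit increase `δ(I ∪ {i}) ≤ δ I + 1`).
`IsCorank n d δ` records all five. Results (all elementary; OURS route, no source proof exists in [Hu25]):
* `forall_le_card_inter_iff` — «`x_u ∈ Δ_d`» (`∀ I, δ I ≤ |u ∩ I|`) `↔ δ([n] ∖ u) = 0` («`u` is a basis»);
* `exists_indep_spanning` — every `J` contains an independent `S` (`δ Sᶜ + |S| = d`) of the same rank (`δ Sᶜ = δ Jᶜ`);
* `exists_base_superset` — every independent `S` extends to a basis;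
* `exists_base_card_inter_eq`, `eq_of_bases` — `δ I = min_{u basis} |u ∩ I|`, so a corank function is determined by its bases.
Kernel support for OUR typed readings; nothing of [Hu25]/[La03] is asserted. AI typing/proving is weaker than expert review.
-/
namespace Literature.AlgebraicGeometry.Hu2025.Statements.S01S09Interface

namespace Prop9_1Ours

variable {n d : ℕ}

/-- An abstract «corank function» on the subsets of `[n] = Fin n`: the properties of `I ↦ dim(F ∩ E_I)` for a `d`-plane `F`
(the three printed properties of [Hu25] §9 plus monotonicity and unit increase).
[cite: Hu2025, §9 / Proposition 9.1 chunk p0072 l.24–34, l.71–82 (unrefereed preprint arXiv:2507.21400v1 under adjudication, D-0012/D-0089 — kernel support on OUR typed carriers of row 110; nothing of the source asserted; [La03] primary unread)] -/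
structure IsCorank (n d : ℕ) (δ : Finset (Fin n) → ℕ) : Prop where
  /-- «`d_∅ = 0`» -/
  empty : δ ∅ = 0
  /-- «`d_[n] = d`» -/
  univ : δ Finset.univ = d
  /-- monotone (not printed; automatic for `dim(F ∩ E_I)`) -/
  mono : ∀ ⦃I J : Finset (Fin n)⦄, I ⊆ J → δ I ≤ δ J
  /-- unit increase (not printed; automatic for `dim(F ∩ E_I)`) -/
  insert_le : ∀ (i : Fin n) (I : Finset (Fin n)), δ (insert i I) ≤ δ I + 1
  /-- «`d_I + d_J ≤ d_{I∪J} + d_{I∩J}`» -/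
  supermod : ∀ I J : Finset (Fin n), δ I + δ J ≤ δ (I ∪ J) + δ (I ∩ J)

namespace IsCorank

variable {δ δ' : Finset (Fin n) → ℕ}

/-- `δ I ≤ d` for a corank function (monotonicity and `δ [n] = d`).
[cite: Hu2025, §9 / Proposition 9.1 chunk p0072 l.24–34, l.71–82 (unrefereed preprint arXiv:2507.21400v1 under adjudication, D-0012/D-0089 — kernel support on OUR typed carriers of row 110; nothing of the source asserted; [La03] primary unread)] -/
theorem le_d (h : IsCorank n d δ) (I : Finset (Fin n)) : δ I ≤ d := by
  rw [← h.univ]; exact h.mono (Finset.subset_univ I)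

/-- `δ (I ∪ T) ≤ δ I + |T|` (iterated unit increase).
[cite: Hu2025, §9 / Proposition 9.1 chunk p0072 l.24–34, l.71–82 (unrefereed preprint arXiv:2507.21400v1 under adjudication, D-0012/D-0089 — kernel support on OUR typed carriers of row 110; nothing of the source asserted; [La03] primary unread)] -/
theorem union_le_add_card (h : IsCorank n d δ) (I T : Finset (Fin n)) : δ (I ∪ T) ≤ δ I + T.card := by
  classical
  induction T using Finset.induction_on with
  | empty => simp
  | @insert t T ht ih =>
    rw [Finset.union_insert, Finset.card_insert_of_notMem ht]
    calc δ (insert t (I ∪ T)) ≤ δ (I ∪ T) + 1 := h.insert_le t _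
      _ ≤ δ I + (T.card + 1) := by omega

/-- `d ≤ δ Jᶜ + |J|` (the «rank» `d − δ Jᶜ` of `J` is at most `|J|`).
[cite: Hu2025, §9 / Proposition 9.1 chunk p0072 l.24–34, l.71–82 (unrefereed preprint arXiv:2507.21400v1 under adjudication, D-0012/D-0089 — kernel support on OUR typed carriers of row 110; nothing of the source asserted; [La03] primary unread)] -/
theorem d_le_compl_add_card (h : IsCorank n d δ) (J : Finset (Fin n)) : d ≤ δ Jᶜ + J.card := by
  have := h.union_le_add_card Jᶜ J
  rwa [Finset.union_comm, Finset.union_compl, h.univ] at this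

/-- erasing one element lowers `δ` by at most one
[cite: Hu2025, §9 / Proposition 9.1 chunk p0072 l.24–34, l.71–82 (unrefereed preprint arXiv:2507.21400v1 under adjudication, D-0012/D-0089 — kernel support on OUR typed carriers of row 110; nothing of the source asserted; [La03] primary unread)] -/
theorem le_erase_add_one (h : IsCorank n d δ) {j : Fin n} {I : Finset (Fin n)} (hj : j ∈ I) :
    δ I ≤ δ (I.erase j) + 1 := by
  have := h.insert_le j (I.erase j)
  rwa [Finset.insert_erase hj] at this

/-- **Vertices of `Δ_d` = bases**: `(∀ I, δ I ≤ |u ∩ I|) ↔ δ uᶜ = 0` (monotonicity + unit increase only).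
[cite: Hu2025, §9 / Proposition 9.1 chunk p0072 l.24–34, l.71–82 (unrefereed preprint arXiv:2507.21400v1 under adjudication, D-0012/D-0089 — kernel support on OUR typed carriers of row 110; nothing of the source asserted; [La03] primary unread)] -/
theorem forall_le_card_inter_iff (h : IsCorank n d δ) (u : Finset (Fin n)) :
    (∀ I : Finset (Fin n), δ I ≤ (u ∩ I).card) ↔ δ uᶜ = 0 := by
  constructor
  · intro hI
    have := hI uᶜ
    rw [Finset.inter_compl] at this
    simpa using this
  · intro hu I
    have hsub : I ⊆ uᶜ ∪ (u ∩ I) := by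
      intro x hx
      by_cases hxu : x ∈ u
      · exact Finset.mem_union_right _ (Finset.mem_inter.mpr ⟨hxu, hx⟩)
      · exact Finset.mem_union_left _ (Finset.mem_compl.mpr hxu)
    calc δ I ≤ δ (uᶜ ∪ (u ∩ I)) := h.mono hsub
      _ ≤ δ uᶜ + (u ∩ I).card := h.union_le_add_card _ _
      _ = (u ∩ I).card := by rw [hu, Nat.zero_add]

/-- **Independent spanning subset**: every `J` contains an `S` with `δ Sᶜ + |S| = d` («`S` independent») and
`δ Sᶜ = δ Jᶜ` («same rank as `J`»).
[cite: Hu2025, §9 / Proposition 9.1 chunk p0072 l.24–34, l.71–82 (unrefereed preprint arXiv:2507.21400v1 under adjudication, D-0012/D-0089 — kernel support on OUR typed carriers of row 110; nothing of the source asserted; [La03] primary unread)] -/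
theorem exists_indep_spanning (h : IsCorank n d δ) (J : Finset (Fin n)) :
    ∃ S ⊆ J, δ Sᶜ + S.card = d ∧ δ Sᶜ = δ Jᶜ := by
  classical
  induction J using Finset.induction_on with
  | empty => exact ⟨∅, subset_rfl, by simp [h.univ], rfl⟩
  | @insert j J hj ih =>
    obtain ⟨S, hSJ, hSd, hSJ'⟩ := ih
    have hjS : j ∉ S := fun h' => hj (hSJ h')
    have hjc : j ∈ Jᶜ := Finset.mem_compl.mpr hj
    have hcompl : (insert j J)ᶜ = Jᶜ.erase j := Finset.compl_insert
    have h1 : δ (Jᶜ.erase j) ≤ δ Jᶜ := h.mono (Finset.erase_subset _ _)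
    have h2 : δ Jᶜ ≤ δ (Jᶜ.erase j) + 1 := h.le_erase_add_one hjc
    by_cases heq : δ (Jᶜ.erase j) = δ Jᶜ
    · refine ⟨S, hSJ.trans (Finset.subset_insert _ _), hSd, ?_⟩
      rw [hcompl, heq, hSJ']
    · -- the rank went up: add `j` to `S`
      have hlt : δ (Jᶜ.erase j) + 1 = δ Jᶜ := by omega
      have hjSc : j ∈ Sᶜ := Finset.mem_compl.mpr hjS
      have hJS : Jᶜ ⊆ Sᶜ := Finset.compl_subset_compl.mpr hSJ
      -- supermodularity with A = Sᶜ.erase j, B = Jᶜ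
      have hAB : Sᶜ.erase j ∪ Jᶜ = Sᶜ := by
        ext x
        simp only [Finset.mem_union, Finset.mem_erase]
        constructor
        · rintro (⟨-, hx⟩ | hx)
          · exact hx
          · exact hJS hx
        · intro hx
          by_cases hxj : x = j
          · subst hxj; exact Or.inr hjc
          · exact Or.inl ⟨hxj, hx⟩
      have hAB' : Sᶜ.erase j ∩ Jᶜ = Jᶜ.erase j := by
        ext x
        simp only [Finset.mem_inter, Finset.mem_erase]
        constructor
        · rintro ⟨⟨hxj, -⟩, hx⟩; exact ⟨hxj, hx⟩
        · rintro ⟨hxj, hx⟩; exact ⟨⟨hxj, hJS hx⟩, hx⟩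
      have hsm := h.supermod (Sᶜ.erase j) Jᶜ
      rw [hAB, hAB'] at hsm
      have h3 : δ (Sᶜ.erase j) ≤ δ Sᶜ := h.mono (Finset.erase_subset _ _)
      have h4 : δ Sᶜ ≤ δ (Sᶜ.erase j) + 1 := h.le_erase_add_one hjSc
      have hS1 : δ (Sᶜ.erase j) + 1 = δ Sᶜ := by omega
      refine ⟨insert j S, Finset.insert_subset_insert _ hSJ, ?_, ?_⟩
      · rw [Finset.compl_insert, Finset.card_insert_of_notMem hjS]; omega
      · rw [Finset.compl_insert, hcompl]; omega

/-- if no single erasure lowers `δ` on `Sᶜ`, then no erasure of any subset does (supermodularity)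
[cite: Hu2025, §9 / Proposition 9.1 chunk p0072 l.24–34, l.71–82 (unrefereed preprint arXiv:2507.21400v1 under adjudication, D-0012/D-0089 — kernel support on OUR typed carriers of row 110; nothing of the source asserted; [La03] primary unread)] -/
theorem sdiff_eq_of_forall_erase_eq (h : IsCorank n d δ) (C : Finset (Fin n))
    (hC : ∀ j ∈ C, δ (C.erase j) = δ C) : ∀ T ⊆ C, δ (C \ T) = δ C := by
  classical
  intro T
  induction T using Finset.induction_on with
  | empty => intro; simp
  | @insert t T ht ih =>
    intro hT
    have htC : t ∈ C := hT (Finset.mem_insert_self _ _)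
    have hTC : T ⊆ C := (Finset.subset_insert _ _).trans hT
    have ih' := ih hTC
    have hAB : C \ T ∪ C.erase t = C := by
      ext x
      simp only [Finset.mem_union, Finset.mem_sdiff, Finset.mem_erase]
      constructor
      · rintro (⟨hx, -⟩ | ⟨-, hx⟩) <;> exact hx
      · intro hx
        by_cases hxt : x = t
        · subst hxt; exact Or.inl ⟨hx, ht⟩
        · exact Or.inr ⟨hxt, hx⟩
    have hAB' : C \ T ∩ C.erase t = C \ insert t T := by
      ext x
      simp only [Finset.mem_inter, Finset.mem_sdiff, Finset.mem_erase, Finset.mem_insert, not_or]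
      tauto
    have hsm := h.supermod (C \ T) (C.erase t)
    rw [hAB, hAB', ih', hC t htC] at hsm
    have hle : δ (C \ insert t T) ≤ δ C := h.mono Finset.sdiff_subset
    omega

/-- **Basis extension**: an «independent» `S` (`δ Sᶜ + |S| = d`) extends to a «basis» `u ⊇ S` (`|u| = d`, `δ uᶜ = 0`).
[cite: Hu2025, §9 / Proposition 9.1 chunk p0072 l.24–34, l.71–82 (unrefereed preprint arXiv:2507.21400v1 under adjudication, D-0012/D-0089 — kernel support on OUR typed carriers of row 110; nothing of the source asserted; [La03] primary unread)] -/
theorem exists_base_superset (h : IsCorank n d δ) :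
    ∀ (m : ℕ) (S : Finset (Fin n)), δ Sᶜ = m → δ Sᶜ + S.card = d →
      ∃ u : Finset (Fin n), S ⊆ u ∧ u.card = d ∧ δ uᶜ = 0 := by
  classical
  intro m
  induction m with
  | zero => intro S h0 hSd; exact ⟨S, subset_rfl, by omega, h0⟩
  | succ m ih =>
    intro S hm hSd
    -- some erasure lowers δ on Sᶜ
    have hex : ∃ j ∈ Sᶜ, δ (Sᶜ.erase j) < δ Sᶜ := by
      by_contra hne
      push Not at hne
      have hall : ∀ j ∈ Sᶜ, δ (Sᶜ.erase j) = δ Sᶜ :=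
        fun j hj => le_antisymm (h.mono (Finset.erase_subset _ _)) (hne j hj)
      have := h.sdiff_eq_of_forall_erase_eq Sᶜ hall Sᶜ subset_rfl
      rw [Finset.sdiff_self, h.empty] at this
      omega
    obtain ⟨j, hj, hlt⟩ := hex
    have hjS : j ∉ S := Finset.mem_compl.mp hj
    have hle := h.le_erase_add_one hj
    have hm' : δ (insert j S)ᶜ = m := by rw [Finset.compl_insert]; omega
    have hSd' : δ (insert j S)ᶜ + (insert j S).card = d := by
      rw [Finset.compl_insert, Finset.card_insert_of_notMem hjS]; omega
    obtain ⟨u, hSu, hud, hu0⟩ := ih (insert j S) hm' hSd'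
    exact ⟨u, (Finset.subset_insert _ _).trans hSu, hud, hu0⟩

/-- every «basis» bounds `δ`: `δ I ≤ |u ∩ I|`
[cite: Hu2025, §9 / Proposition 9.1 chunk p0072 l.24–34, l.71–82 (unrefereed preprint arXiv:2507.21400v1 under adjudication, D-0012/D-0089 — kernel support on OUR typed carriers of row 110; nothing of the source asserted; [La03] primary unread)] -/
theorem le_card_inter_of_base (h : IsCorank n d δ) {u : Finset (Fin n)} (hu : δ uᶜ = 0) (I : Finset (Fin n)) :
    δ I ≤ (u ∩ I).card :=
  (h.forall_le_card_inter_iff u).2 hu I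

/-- … and some «basis» attains it: `δ I = min_u |u ∩ I|`.
[cite: Hu2025, §9 / Proposition 9.1 chunk p0072 l.24–34, l.71–82 (unrefereed preprint arXiv:2507.21400v1 under adjudication, D-0012/D-0089 — kernel support on OUR typed carriers of row 110; nothing of the source asserted; [La03] primary unread)] -/
theorem exists_base_card_inter_eq (h : IsCorank n d δ) (I : Finset (Fin n)) :
    ∃ u : Finset (Fin n), u.card = d ∧ δ uᶜ = 0 ∧ (u ∩ I).card = δ I := by
  classical
  obtain ⟨S, hSI, hSd, hSI'⟩ := h.exists_indep_spanning Iᶜ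
  rw [compl_compl] at hSI'
  obtain ⟨u, hSu, hud, hu0⟩ := h.exists_base_superset _ S rfl hSd
  refine ⟨u, hud, hu0, le_antisymm ?_ (h.le_card_inter_of_base hu0 I)⟩
  -- `u ∩ I` and `S` are disjoint subsets of `u`
  have hdisj : Disjoint (u ∩ I) S := by
    rw [Finset.disjoint_left]
    intro x hx hxS
    exact Finset.mem_compl.mp (hSI hxS) (Finset.mem_inter.mp hx).2
  have hcard : (u ∩ I).card + S.card ≤ u.card := by
    rw [← Finset.card_union_of_disjoint hdisj]
    exact Finset.card_le_card (Finset.union_subset Finset.inter_subset_left hSu)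
  omega

/-- **A corank function is determined by its bases.**
[cite: Hu2025, §9 / Proposition 9.1 chunk p0072 l.24–34, l.71–82 (unrefereed preprint arXiv:2507.21400v1 under adjudication, D-0012/D-0089 — kernel support on OUR typed carriers of row 110; nothing of the source asserted; [La03] primary unread)] -/
theorem eq_of_bases (h : IsCorank n d δ) (h' : IsCorank n d δ')
    (hB : ∀ u : Finset (Fin n), u.card = d → (δ uᶜ = 0 ↔ δ' uᶜ = 0)) : δ = δ' := by
  funext I
  obtain ⟨u, hud, hu0, huI⟩ := h.exists_base_card_inter_eq I
  obtain ⟨u', hud', hu0', huI'⟩ := h'.exists_base_card_inter_eq I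
  have h1 := h'.le_card_inter_of_base ((hB u hud).1 hu0) I
  have h2 := h.le_card_inter_of_base ((hB u' hud').2 hu0') I
  omega

end IsCorank
end Prop9_1Ours
end Literature.AlgebraicGeometry.Hu2025.Statements.S01S09Interface
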